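import Literature.Topology.FourManifolds.BasinConj
import HarnessLib

/-!
# The basin setting: saturations of compact subsets of `L ∩ basin`

Topic `Literature/Topology/FourManifolds`; sixth file of the endgame of the Torelli half of
Griffiths' handlebody theorem.  Everything here is **proved**.

For `B : BasinSetting g ξ` and a compact `K' ⊆ L ∩ basin` (in the application: the push of
the support of the boundary diffeomorphism):
* `exists_forall_apply_θ_lt` — **uniform descent**: after a time `T` every backward flow line
  from `K'` stays in `{g < g p₀ + ε}` (as in `OneHandlebodyBasin.lean`, §2);
* `closure_lowerSat_subset`, `closure_upperSat_subset`, `closure_sat_subset` — **the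
  saturation of `K'` below a level `m < hi` accumulates only inside the domain of the level
  conjugation or at `p₀`** (points reached in bounded time form a compact subset of the domain,
  the others are uniformly close to `p₀` in value; above `L` the saturation is closed).
This is what makes the level conjugation of a boundary diffeomorphism supported in `K` equal to
the identity near the trajectories going to the other critical points.

## References

* J. Milnor, *Lectures on the h-cobordism theorem*, notes by L. Siebenmann and J. Sondow,
  Princeton Mathematical Notes (1965): Def. 3.1, proof of Thm. 3.4 (PDF pp. 11–13), Def. 3.9
  (PDF p. 16), Thm. 4.1 (PDF p. 22), proof of Thm. 5.4, Assertion 4 (PDF p. 29).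
  [MilnorHCobordism1965]
* J. Milnor, *Morse theory* (1963), Thm. 3.1 and proof of Thm. 4.1 (p. 25). [Milnor1963]
* H. B. Griffiths, *Automorphisms of a 3-dimensional handlebody*, Abh. Math. Sem. Univ. Hamburg
  26 (1964), §§3–6. [GriffithsHB1964Handlebody]
-/

open scoped Manifold ContDiff Topology
open Set Function Filter Metric

noncomputable section

namespace Literature.Topology.FourManifolds

open Cobordism FourManifolds.Flow

universe u

variable {n : ℕ} {W : Type u} [TopologicalSpace W] [T2Space W] [SecondCountableTopology W]
  [CompactSpace W] [ChartedSpace (EuclideanHalfSpace (n + 1)) W] [IsManifold (𝓡∂ (n + 1)) ∞ W]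

/-! ### Saturations of compact subsets of `L ∩ basin`: uniform descent to `p₀` and closures -/

namespace BasinSetting

variable {g : W → ℝ} {ξ : Π x : W, TangentSpace (𝓡∂ (n + 1)) x} (B : BasinSetting g ξ)

/-- **Uniform descent to the minimum.**  For a compact set `K'` of points of `{g ≤ hi}` in the
basin and `ε > 0` there is a time `T` after which every backward flow line from `K'` stays in
`{g < g p₀ + ε}` (pointwise convergence to `p₀`, continuity in the starting point, monotonicity
of `g` along the flow, compactness). [cite: MilnorHCobordism1965, Def. 3.1, proof of Thm. 4.1 (PDF p. 22)] -/
theorem exists_forall_apply_θ_lt {K' : Set W} (hK' : IsCompact K') (hK'b : K' ⊆ B.basin)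
    (hK'hi : ∀ w ∈ K', g w ≤ B.hi) {ε : ℝ} (hε : 0 < ε) :
    ∃ T : ℝ, 0 ≤ T ∧ ∀ w ∈ K', ∀ t, T ≤ t → g (B.θ (-t, w)) < g B.p₀ + ε := by
  have hgc : Continuous g := B.isMorseFunction.isMorse.contMDiff.continuous
  set O : ℝ → Set W := fun T => {z | g (B.θ (-T, z)) < g B.p₀ + ε} with hO
  have hOopen : ∀ T, IsOpen (O T) := fun T =>
    isOpen_lt (hgc.comp (B.continuous_θ.comp (Continuous.prodMk_right (-T)))) continuous_const
  have hOdir : Directed (· ⊆ ·) (fun T : Ici (0 : ℝ) => O T) := by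
    rintro ⟨T, hT⟩ ⟨T', hT'⟩
    refine ⟨⟨max T T', Set.mem_Ici.2 (le_max_of_le_left hT)⟩, fun z hz => ?_, fun z hz => ?_⟩
    · exact lt_of_le_of_lt (B.monotone_apply_θ z (neg_le_neg (le_max_left T T'))) hz
    · exact lt_of_le_of_lt (B.monotone_apply_θ z (neg_le_neg (le_max_right T T'))) hz
  have hKO : K' ⊆ ⋃ T : Ici (0 : ℝ), O T := by
    intro w hw
    have hconv := (B.mem_basin_iff_tendsto (hK'hi w hw)).1 (hK'b hw)
    have hev : ∀ᶠ t in atBot, g (B.θ (t, w)) < g B.p₀ + ε :=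
      ((hgc.tendsto _).comp hconv).eventually (Iio_mem_nhds (by linarith))
    obtain ⟨t, ht, ht0⟩ := (hev.and (eventually_le_atBot 0)).exists
    refine mem_iUnion.2 ⟨⟨-t, by simpa using ht0⟩, ?_⟩
    show g (B.θ (-(-t), w)) < g B.p₀ + ε
    rw [neg_neg]; exact ht
  haveI : Nonempty (Ici (0 : ℝ)) := ⟨⟨0, Set.mem_Ici.2 le_rfl⟩⟩
  obtain ⟨⟨T, hT⟩, hTK⟩ := hK'.elim_directed_cover (fun T : Ici (0 : ℝ) => O T) (fun T => hOopen T) hKO hOdir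
  refine ⟨T, hT, fun w hw t ht => ?_⟩
  exact lt_of_le_of_lt (B.monotone_apply_θ w (neg_le_neg ht)) (hTK hw)

/-- **The lower saturation of a compact subset of `L ∩ basin` accumulates only inside the domain
or at `p₀`**: the closure of the set of points of `{g ≤ L}` whose trajectory meets `L` inside the
compact set `K' ⊆ L ∩ basin` is contained in `dom ∪ {p₀}`.  (Points reached from `K'` in bounded
time form a compact subset of the domain; the others are uniformly close to `p₀` in value.)
[cite: MilnorHCobordism1965, Thm. 4.1 (PDF p. 22)] -/
theorem closure_lowerSat_subset {K' : Set W} (hK' : IsCompact K') (hK'b : K' ⊆ B.basin)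
    (hK'L : ∀ w ∈ K', g w = B.L) :
    closure {x | g x ≤ B.L ∧ Hits B.θ g B.L x ∧ B.top x ∈ K'} ⊆ B.dom ∪ {B.p₀} := by
  intro x hx
  by_cases hxp : x = B.p₀
  · exact Or.inr hxp
  left
  have hgx : g B.p₀ < g x := B.apply_p₀_lt hxp
  set ε : ℝ := (g x - g B.p₀) / 2 with hε
  have hεpos : 0 < ε := by rw [hε]; linarith
  obtain ⟨T, hT0, hT⟩ := B.exists_forall_apply_θ_lt hK' hK'b
    (fun w hw => by rw [hK'L w hw]; exact B.L_lt_hi.le) hεpos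
  -- the compact set of points reached from `K'` in time `≤ T`
  set C : Set W := (fun p : ℝ × W => B.θ (-p.1, p.2)) '' (Icc 0 T ×ˢ K') with hC
  have hCc : IsCompact C := (isCompact_Icc.prod hK').image
    (B.continuous_θ.comp (continuous_fst.neg.prodMk continuous_snd))
  have hCdom : C ⊆ B.dom := by
    rintro _ ⟨⟨t, w⟩, ⟨ht, hw⟩, rfl⟩
    have hwL := hK'L w hw
    have hwb := hK'b hw
    have hhit : Hits B.θ g B.L (B.θ (-t, w)) := B.isSmoothFlow.hits_apply_iff.2 (hits_of_apply_eq (B.θ_zero w) hwL)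
    have htop : B.top (B.θ (-t, w)) = w := by rw [B.top_θ (hits_of_apply_eq (B.θ_zero w) hwL), B.top_of_apply_eq hwL]
    refine ⟨?_, hhit, by rw [htop]; exact hwb⟩
    exact lt_of_le_of_lt (B.apply_θ_le (neg_nonpos.2 ht.1)) (by rw [hwL]; exact B.L_lt_hi)
  -- the saturation lies in `C ∪ {g < g p₀ + ε}`
  have hsub : {x | g x ≤ B.L ∧ Hits B.θ g B.L x ∧ B.top x ∈ K'} ⊆ C ∪ {z | g z ≤ g B.p₀ + ε} := by
    rintro z ⟨hzL, hzhit, hztop⟩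
    set τ := hittingTime B.θ g B.L z with hτ
    have hzeq : B.θ (-τ, B.top z) = z := B.θ_neg_hittingTime_top z
    have hτ0 : 0 ≤ τ := by
      by_contra hneg
      rw [not_le] at hneg
      have h1 : g (B.top z) ≤ g z := by rw [top_def]; exact B.apply_θ_le hneg.le
      have h2 : g (B.top z) = B.L := B.apply_top hzhit
      -- then `g z = L` and `τ = 0`
      have h3 : g z = B.L := le_antisymm hzL (h2 ▸ h1)
      have h4 : τ = 0 := B.hittingTime_L_eq (by rw [B.θ_zero]; exact h3)
      linarith
    by_cases hτT : τ ≤ T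
    · exact Or.inl ⟨(τ, B.top z), ⟨⟨hτ0, hτT⟩, hztop⟩, hzeq⟩
    · right
      rw [not_le] at hτT
      have := hT (B.top z) hztop τ hτT.le
      rw [hzeq] at this
      exact this.le
  have hcl : closure {x | g x ≤ B.L ∧ Hits B.θ g B.L x ∧ B.top x ∈ K'} ⊆ C ∪ {z | g z ≤ g B.p₀ + ε} := by
    refine (closure_mono hsub).trans ?_
    rw [(hCc.isClosed.union (isClosed_le B.isMorseFunction.isMorse.contMDiff.continuous
      continuous_const)).closure_eq]
  rcases hcl hx with h | h
  · exact hCdom h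
  · exfalso
    have : g x ≤ g B.p₀ + ε := h
    rw [hε] at this
    linarith

/-- **The upper saturation is closed and lies in the domain**: the points of the closed slab
`{L ≤ g ≤ m}`, `m < hi`, whose top lies in the compact `K' ⊆ L ∩ basin` form a closed subset of
the domain. [cite: MilnorHCobordism1965, Thm. 4.1 (PDF p. 22)] -/
theorem closure_upperSat_subset {K' : Set W} (hK' : IsCompact K') (hK'b : K' ⊆ B.basin)
    {m : ℝ} (hm : m < B.hi) :
    closure {x | g x ∈ Icc B.L m ∧ B.top x ∈ K'} ⊆ B.dom := by
  have hgc : Continuous g := B.isMorseFunction.isMorse.contMDiff.continuous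
  have hslab : IsClosed {x : W | g x ∈ Icc B.L m} := isClosed_Icc.preimage hgc
  have hcont : ContinuousOn B.top {x : W | g x ∈ Icc B.L m} := fun x hx =>
    (B.contMDiffAt_top (hx.2.trans_lt (hm.trans B.hi_lt_one))
      (B.hits_L_of_L_le hx.1 (hx.2.trans hm.le))).continuousAt.continuousWithinAt
  have hcl : IsClosed {x | g x ∈ Icc B.L m ∧ B.top x ∈ K'} := by
    have := hcont.preimage_isClosed_of_isClosed hslab hK'.isClosed
    convert this using 1
    ext x; simp only [mem_setOf_eq, mem_inter_iff, mem_preimage]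
  rw [hcl.closure_eq]
  rintro x ⟨hx, htop⟩
  exact ⟨hx.2.trans_lt hm, B.hits_L_of_L_le hx.1 (hx.2.trans hm.le), hK'b htop⟩

/-- **The saturation below `m < hi` of a compact subset `K'` of `L ∩ basin` accumulates only in
the domain or at `p₀`.** [cite: MilnorHCobordism1965, Thm. 4.1 (PDF p. 22)] -/
theorem closure_sat_subset {K' : Set W} (hK' : IsCompact K') (hK'b : K' ⊆ B.basin)
    (hK'L : ∀ w ∈ K', g w = B.L) {m : ℝ} (hm : m < B.hi) :
    closure {x | x ∈ B.dom ∧ g x ≤ m ∧ B.top x ∈ K'} ⊆ B.dom ∪ {B.p₀} := by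
  have hsub : {x | x ∈ B.dom ∧ g x ≤ m ∧ B.top x ∈ K'} ⊆
      {x | g x ≤ B.L ∧ Hits B.θ g B.L x ∧ B.top x ∈ K'} ∪ {x | g x ∈ Icc B.L m ∧ B.top x ∈ K'} := by
    rintro x ⟨hx, hxm, htop⟩
    rcases le_or_gt (g x) B.L with h | h
    · exact Or.inl ⟨h, hx.2.1, htop⟩
    · exact Or.inr ⟨⟨h.le, hxm⟩, htop⟩
  intro x hx
  have hx' := (closure_mono hsub) hx
  rw [closure_union] at hx'
  rcases hx' with h | h
  · exact B.closure_lowerSat_subset hK' hK'b hK'L h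
  · exact Or.inl (B.closure_upperSat_subset hK' hK'b hm h)

end BasinSetting

end Literature.Topology.FourManifolds
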